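import Literature.MathematicalPhysics.KineticTheory.FouriersLaw
import Literature.MathematicalPhysics.KineticTheory.InfiniteChainDynamics
import Literature.MathematicalPhysics.KineticTheory.InfiniteChainInvariantStates

/-!
# Crux triage r1-1, idea `flat-without-current-liouville` (crux stmt-AtomisticToContinuum-9141):
# the zero-current hypothesis of its First lemma `ZeroCurrentDerivationsAreFlat` is INERT as typed

`LinearGrowthDerivation` and `ZeroCurrentDerivationsAreFlat` below are VERBATIM copies of the card's
typed First lemma (tree file `Cruxes/BoundedResponseConverges/SketchIdeator2.lean`, namespace `…Sketch2`).

Finding (kernel-checked here): the structure constrains the total functional `Λ` only on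
`IsLocalTestFunction`s (bounded `C¹` cylinder functions) and on the Liouvillian images of those; the
zero-current hypothesis evaluates `Λ` at the UNBOUNDED observable `j₀ = bondCurrentZ σ 0`, where the
structure says nothing. Truncating any derivation to `0` off the bounded functions gives a derivation with
the same values on local test functions and "zero current". Hence

  `ZeroCurrentDerivationsAreFlat ↔ AllDerivationsAreFlat`

(`zeroCurrent_hypothesis_inert`): as typed, the stub asserts that EVERY regular stationary linear-growth
derivation is translation invariant — including the current-carrying blow-up limit the card itself needs
to be tilted (slope `-j/κ_*`). So the typed stub contradicts the card's own mechanism; and the intended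
statement (with `Λ` extended coherently to polynomial observables) is refuted on paper by BN-1
(`NegativeNoteIdeator3.md`: `E = X + u_even` is stationary, zero-current, tilted).
-/

noncomputable section

open MeasureTheory Filter Topology Set
open scoped Classical
open Literature.MathematicalPhysics.KineticTheory.HeatConduction

namespace Summit.AtomisticToContinuum.FouriersLaw.Cruxes.BoundedResponseConverges.Triage1

/-! ### Verbatim copies of the card's typed objects (SketchIdeator2.lean) -/

/-- inverse shift `(τ⁻¹σ)_x = σ_{x−1}`. -/
def unshift (σ : ChainConfig) : ChainConfig := fun x => σ (x - 1)

/-- VERBATIM copy of `Sketch2.LinearGrowthDerivation`. -/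
structure LinearGrowthDerivation (P : OscillatorChain) (μ : Measure ChainConfig) where
  /-- the functional (total; only its values on local observables matter) -/
  Λ : (ChainConfig → ℝ) → ℝ
  add : ∀ f g, IsLocalTestFunction f → IsLocalTestFunction g → Λ (f + g) = Λ f + Λ g
  smul : ∀ (c : ℝ) (f), IsLocalTestFunction f → Λ (c • f) = c * Λ f
  stationary : ∀ f, IsLocalTestFunction f → Λ (liouvilleZ P f) = 0
  regular : ∀ R : ℕ, ∃ g : ChainConfig → ℝ, MemLp g 2 μ ∧
    ∀ f, IsLocalTestFunction f → (∃ h, f = h ∘ boxRestrict R) → Λ f = ∫ σ, g σ * f σ ∂μ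
  growth : ∀ f, IsLocalTestFunction f → ∃ C : ℝ, ∀ n : ℕ,
    |Λ (f ∘ shift^[n])| ≤ C * (1 + n) ∧ |Λ (f ∘ unshift^[n])| ≤ C * (1 + n)

/-- VERBATIM copy of `Sketch2.ZeroCurrentDerivationsAreFlat` (the card's First lemma). -/
def ZeroCurrentDerivationsAreFlat : Prop :=
  ∀ ω₂ lam β : ℝ, 0 < ω₂ → 0 < lam → 0 < β → ∀ T : ℝ, 0 < T →
    ∀ μ : Measure ChainConfig, (pinnedChain ω₂ lam β 1).IsChainGibbsMeasure T μ →
    ∀ Λ : LinearGrowthDerivation (pinnedChain ω₂ lam β 1) μ,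
      Λ.Λ (fun σ => (pinnedChain ω₂ lam β 1).bondCurrentZ σ 0) = 0 →
      ∀ f, IsLocalTestFunction f → Λ.Λ (f ∘ shift) = Λ.Λ f

/-- The same statement with the zero-current hypothesis DELETED: every regular stationary
linear-growth derivation of the infinite pinned chain is translation invariant. -/
def AllDerivationsAreFlat : Prop :=
  ∀ ω₂ lam β : ℝ, 0 < ω₂ → 0 < lam → 0 < β → ∀ T : ℝ, 0 < T →
    ∀ μ : Measure ChainConfig, (pinnedChain ω₂ lam β 1).IsChainGibbsMeasure T μ →
    ∀ Λ : LinearGrowthDerivation (pinnedChain ω₂ lam β 1) μ,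
      ∀ f, IsLocalTestFunction f → Λ.Λ (f ∘ shift) = Λ.Λ f

/-! ### Bounded observables -/

/-- `f` is a bounded function on configurations. -/
def IsBdd (f : ChainConfig → ℝ) : Prop := ∃ M : ℝ, ∀ σ, |f σ| ≤ M

theorem isBdd_of_isLocalTestFunction {f : ChainConfig → ℝ} (hf : IsLocalTestFunction f) : IsBdd f := by
  obtain ⟨R, g, -, ⟨M, hM⟩, -, rfl⟩ := hf
  exact ⟨M, fun σ => hM _⟩

theorem IsBdd.add {f g : ChainConfig → ℝ} (hf : IsBdd f) (hg : IsBdd g) : IsBdd (f + g) := by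
  obtain ⟨M, hM⟩ := hf
  obtain ⟨M', hM'⟩ := hg
  refine ⟨M + M', fun σ => ?_⟩
  simp only [Pi.add_apply]
  exact (abs_add_le _ _).trans (add_le_add (hM σ) (hM' σ))

theorem IsBdd.smul (c : ℝ) {f : ChainConfig → ℝ} (hf : IsBdd f) : IsBdd (c • f) := by
  obtain ⟨M, hM⟩ := hf
  refine ⟨|c| * M, fun σ => ?_⟩
  simp only [Pi.smul_apply, smul_eq_mul, abs_mul]
  exact mul_le_mul_of_nonneg_left (hM σ) (abs_nonneg c)

theorem IsBdd.comp {f : ChainConfig → ℝ} (hf : IsBdd f) (φ : ChainConfig → ChainConfig) :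
    IsBdd (f ∘ φ) := by
  obtain ⟨M, hM⟩ := hf
  exact ⟨M, fun σ => hM (φ σ)⟩

/-- The energy current `j₀` of the pinned chain is NOT a bounded observable (so in particular not a
local test function): at `q₀ = 0, q₁ = 1, p₀ = p₁ = t` it equals `-t (1 + β)`. -/
theorem not_isBdd_bondCurrentZ (ω₂ lam β γ : ℝ) (hβ : 0 ≤ β) :
    ¬ IsBdd (fun σ => (pinnedChain ω₂ lam β γ).bondCurrentZ σ 0) := by
  rintro ⟨M, hM⟩
  have hM0 : 0 ≤ M := (abs_nonneg _).trans (hM fun _ => (0, 0))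
  set t : ℝ := M + 1 with ht
  let σ : ChainConfig := fun x => if x = 0 then (0, t) else if x = 1 then (1, t) else (0, 0)
  have hV : (pinnedChain ω₂ lam β γ).V = fun r => r ^ 2 / 2 + β * r ^ 4 / 4 := rfl
  have hd : deriv (pinnedChain ω₂ lam β γ).V 1 = 1 + β := by
    rw [hV]
    have h : HasDerivAt (fun r : ℝ => r ^ 2 / 2 + β * r ^ 4 / 4)
        (((2 : ℕ) : ℝ) * (1 : ℝ) ^ (2 - 1) / 2 + β * (((4 : ℕ) : ℝ) * (1 : ℝ) ^ (4 - 1)) / 4) 1 :=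
      ((hasDerivAt_pow 2 (1 : ℝ)).div_const 2).add
        (((hasDerivAt_pow 4 (1 : ℝ)).const_mul β).div_const 4)
    rw [h.deriv]
    norm_num
  have hj : (pinnedChain ω₂ lam β γ).bondCurrentZ σ 0 = -(t * (1 + β)) := by
    simp only [OscillatorChain.bondCurrentZ]
    have h0 : σ 0 = (0, t) := by simp [σ]
    have h1 : σ (0 + 1) = (1, t) := by simp [σ]
    rw [h0, h1]
    simp only [sub_zero]
    rw [hd]
    ring
  have hb := hM σ
  simp only [hj, abs_neg] at hb
  have h1 : t ≤ t * (1 + β) := by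
    have : 0 ≤ t := by rw [ht]; linarith
    nlinarith
  have h2 : |t * (1 + β)| = t * (1 + β) := abs_of_nonneg (by nlinarith)
  rw [h2] at hb
  linarith

/-! ### Truncation: kill `Λ` off the bounded observables -/

/-- Truncate a derivation: keep its values on bounded observables, send every unbounded observable to `0`.
All five structure fields survive, because they only ever look at bounded arguments or ask for the value `0`. -/
def truncate {P : OscillatorChain} {μ : Measure ChainConfig} (Λ : LinearGrowthDerivation P μ) :
    LinearGrowthDerivation P μ where
  Λ := fun g => if IsBdd g then Λ.Λ g else 0
  add := by
    intro f g hf hg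
    have hbf := isBdd_of_isLocalTestFunction hf
    have hbg := isBdd_of_isLocalTestFunction hg
    have hfg : IsBdd (f + g) := hbf.add hbg
    simp only [if_pos hbf, if_pos hbg, if_pos hfg]
    exact Λ.add f g hf hg
  smul := by
    intro c f hf
    have hbf := isBdd_of_isLocalTestFunction hf
    have hcf : IsBdd (c • f) := hbf.smul c
    simp only [if_pos hbf, if_pos hcf]
    exact Λ.smul c f hf
  stationary := by
    intro f hf
    by_cases h : IsBdd (liouvilleZ P f)
    · simp only [if_pos h]
      exact Λ.stationary f hf
    · simp only [if_neg h]
  regular := by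
    intro R
    obtain ⟨g, hg, hrep⟩ := Λ.regular R
    refine ⟨g, hg, fun f hf hh => ?_⟩
    simp only [if_pos (isBdd_of_isLocalTestFunction hf)]
    exact hrep f hf hh
  growth := by
    intro f hf
    obtain ⟨C, hC⟩ := Λ.growth f hf
    refine ⟨C, fun n => ?_⟩
    have h1 : IsBdd (f ∘ shift^[n]) := (isBdd_of_isLocalTestFunction hf).comp _
    have h2 : IsBdd (f ∘ unshift^[n]) := (isBdd_of_isLocalTestFunction hf).comp _
    simp only [if_pos h1, if_pos h2]
    exact hC n

theorem truncate_apply {P : OscillatorChain} {μ : Measure ChainConfig} (Λ : LinearGrowthDerivation P μ)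
    (g : ChainConfig → ℝ) : (truncate Λ).Λ g = if IsBdd g then Λ.Λ g else 0 := rfl

theorem truncate_apply_of_isBdd {P : OscillatorChain} {μ : Measure ChainConfig}
    (Λ : LinearGrowthDerivation P μ) {g : ChainConfig → ℝ} (hg : IsBdd g) :
    (truncate Λ).Λ g = Λ.Λ g := by
  rw [truncate_apply, if_pos hg]

theorem truncate_current_zero {μ : Measure ChainConfig} (ω₂ lam β γ : ℝ) (hβ : 0 ≤ β)
    (Λ : LinearGrowthDerivation (pinnedChain ω₂ lam β γ) μ) :
    (truncate Λ).Λ (fun σ => (pinnedChain ω₂ lam β γ).bondCurrentZ σ 0) = 0 := by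
  rw [truncate_apply, if_neg (not_isBdd_bondCurrentZ ω₂ lam β γ hβ)]

/-! ### The finding -/

/-- **The zero-current hypothesis is inert**: as typed, the card's First lemma is EQUIVALENT to the
statement that every regular stationary linear-growth derivation is flat. -/
theorem zeroCurrent_hypothesis_inert : ZeroCurrentDerivationsAreFlat ↔ AllDerivationsAreFlat := by
  constructor
  · intro h ω₂ lam β hω hl hβ T hT μ hμ Λ f hf
    have key := h ω₂ lam β hω hl hβ T hT μ hμ (truncate Λ)
      (truncate_current_zero ω₂ lam β 1 hβ.le Λ) f hf
    have hbf := isBdd_of_isLocalTestFunction hf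
    rwa [truncate_apply_of_isBdd Λ (hbf.comp shift), truncate_apply_of_isBdd Λ hbf] at key
  · intro h ω₂ lam β hω hl hβ T hT μ hμ Λ _ f hf
    exact h ω₂ lam β hω hl hβ T hT μ hμ Λ f hf

end Summit.AtomisticToContinuum.FouriersLaw.Cruxes.BoundedResponseConverges.Triage1

end
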